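import Summits.RiemannHypothesis.RiemannHypothesis.Theorems.ThetaTier2Tail
import Summits.RiemannHypothesis.RiemannHypothesis.Theorems.ThetaTier2Cross
import HarnessLib

/-!
# THETA tier-2 kernel checker — `certify_sound`: the kernel verdict packaged as the real facts (K1)–(K7) (cc-s2-1; RH-FREE)

§6(f) of HOME/cc-s2-1/gen22/TIER2-KERNEL-SPEC.md.  `RealAtoms` lists the REAL quantities a row `P = (q, m, δ, η′, seed)` supplies (cell width `τ`,
`θ₀`, `M₀`, `M₁₀`, `c₂`, `ε`, the ζ-residues, `u₁`, `M̄`, `M̄₁`, the tail exponentials, the arch data `e^{t₀/2}, t₀, coefA`, `ΣΛn^{−(m+1)}`, the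
ψ-constant `C`, the lag-tail values, `e^{m(2δ−η′)}`, `χ_L`, `rA`, `rB`, `2 log q/√q`, `log q`, `δ/J`, the gain profile values `Ra_j, Rb_j`, and the cut
values `c̄_j, c̄′_j`); `AtomsOK A X` says every field of the kernel input `A` ENCLOSES the corresponding real of `X` in the direction of SPEC §1
(this is what the atoms layer discharges per row by interval arithmetic); `certifyT2 A` is the kernel verdict `loss < gain` together with the
decidable side conditions (`0 < th0L`, `S ≤ etL`, `S ≤ etH`, `K·hi_{Jt} ≤ 2²⁴·S`, `Jt ≤ Kw`, `0 < Kw`, `1 ≤ m`, `j1p ≤ Jt`), computed with ONE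
shared `stage1`.  **`certify_sound : AtomsOK A X → certifyT2 A = true → T2Valid A X`**, where `T2Valid` packages, in the E-side's vocabulary
(`envE`, `envEp`, `envX`, `lagSum`, `GsR`, `val sLayerN`, `Ā = val Ahi`, `B̄ = val Bhi`):
(K1) the cell envelopes, (K4) the hull facts, the layer facts, and (K7) the single real inequality
`primesC(X) + cross(X, GsR) + arch(X, Ā, B̄) + rterm(X, val sLayerN) < 2·L·(2·Σ_j d·Ra_j·Rb_j)` with `Ā`, `B̄` bounded below by the (K2) cell sums.
Nothing here bears on the truth of RH.
-/

set_option linter.dupNamespace false  -- the mandated namespace repeats `RiemannHypothesis`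
set_option autoImplicit false

namespace Summit.RiemannHypothesis.RiemannHypothesis.Theorems.ThetaTier2

open Real Finset

/-! ## The verdict with its decidable side conditions (one shared `stage1`) -/

/-- `run` with the depth-cell stage supplied. [this cell] -/
def runSt (A : Inp) (st : St) : Out :=
  let mid := stage2 A st
  let cross := crossTerm A st
  let rt := rTerm A st
  { loss := mid.primesC + cross + mid.arch + rt, gain := gainLo A,
    primesC := mid.primesC, cross := cross, arch := mid.arch, rterm := rt, Ahi := mid.Ahi, Bhi := mid.Bhi }

/-- `run A = runSt A (stage1 A)`. [this cell] -/
theorem run_eq_runSt (A : Inp) : run A = runSt A (stage1 A) := by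
  unfold run runSt; rfl

/-- The decidable side conditions of the soundness theorem (data facts about the row's input and the last cell's upper end).
[this cell, TIER2-KERNEL-SPEC §4] -/
def sideNat (A : Inp) (st : St) : Bool :=
  decide (0 < A.th0L) && decide (S ≤ A.etL) && decide (S ≤ A.etH) && decide (A.K * st.hi ≤ 2 ^ 24 * S) &&
    decide (A.Jt ≤ A.Kw) && decide (0 < A.Kw) && decide (1 ≤ A.m) && decide (A.j1p ≤ A.Jt)

/-- **The tier-2 verdict**: side conditions ∧ `loss < gain`, sharing one `stage1` run. [this cell, TIER2-KERNEL-SPEC §2] -/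
def certifyT2 (A : Inp) : Bool :=
  let st := stage1 A
  let o := runSt A st
  sideNat A st && decide (o.loss < o.gain)

/-- What a passing `certifyT2` says, unpacked. [this cell] -/
theorem certifyT2_spec (A : Inp) (h : certifyT2 A = true) :
    0 < A.th0L ∧ S ≤ A.etL ∧ S ≤ A.etH ∧ A.K * (stage1 A).hi ≤ 2 ^ 24 * S ∧ A.Jt ≤ A.Kw ∧ 0 < A.Kw ∧ 1 ≤ A.m ∧ A.j1p ≤ A.Jt ∧
      (runSt A (stage1 A)).loss < (runSt A (stage1 A)).gain := by
  unfold certifyT2 sideNat at h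
  simp only [Bool.and_eq_true, decide_eq_true_eq] at h
  obtain ⟨⟨⟨⟨⟨⟨⟨⟨h1, h2⟩, h3⟩, h4⟩, h5⟩, h6⟩, h7⟩, h8⟩, h9⟩ := h
  exact ⟨h1, h2, h3, h4, h5, h6, h7, h8, h9⟩

/-- The fields of `runSt`. [this cell] -/
theorem runSt_fields (A : Inp) (st : St) :
    (runSt A st).loss = (stage2 A st).primesC + crossTerm A st + (stage2 A st).arch + rTerm A st ∧
    (runSt A st).gain = gainLo A ∧ (runSt A st).Ahi = (stage2 A st).Ahi ∧ (runSt A st).Bhi = (stage2 A st).Bhi := by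
  unfold runSt; exact ⟨rfl, rfl, rfl, rfl⟩

/-! ## The real data of a row and what the atoms must enclose -/

/-- The real quantities of THETA-CERT-cc6 §E that the kernel input encloses (SPEC §1; `cb`, `cpb` = cut values per cell, `Ra`, `Rb` = the two
`R(τ₁(·))` gain-profile values per gain cell). [this cell, TIER2-KERNEL-SPEC §1] -/
structure RealAtoms where
  /-- cell width `τ` -/
  τ : ℝ
  /-- `θ₀ = ζ*/m` -/
  θ₀ : ℝ
  /-- `M₀` -/
  M₀ : ℝ
  /-- `M₁₀` -/
  M₁₀ : ℝ
  /-- `c₂` -/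
  c₂ : ℝ
  /-- `ε` -/
  ε : ℝ
  /-- `ζ(m+1) − Σ_{k≤K} k^{−(m+1)}` -/
  R : ℝ
  /-- `ζ(m) − Σ_{k≤K} k^{−m}` -/
  Rm : ℝ
  /-- `u₁` -/
  u₁ : ℝ
  /-- `M̄` -/
  Mb : ℝ
  /-- `M̄₁` -/
  Mb1 : ℝ
  /-- `e^{−(2m+1)D}` -/
  E1 : ℝ
  /-- `e^{−2mD}` -/
  E2 : ℝ
  /-- `e^{−(2m−1)D}` -/
  E3 : ℝ
  /-- `e^{t₀/2}` -/
  e0 : ℝ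
  /-- `t₀` -/
  t0 : ℝ
  /-- `(2J(t₀) − log 4π − γ − C₁)₊` -/
  cA : ℝ
  /-- `Σ Λ(n) n^{−(m+1)}` -/
  Λ : ℝ
  /-- the ψ-constant `C` -/
  C : ℝ
  /-- the lag-integral tail beyond `W_l` -/
  T : ℝ
  /-- the lag-tail value at `W_l` -/
  Gt : ℝ
  /-- `ζ(m+1)` (envelope beyond depth `D`) -/
  z : ℝ
  /-- `e^{m(2δ−η′)}` -/
  eml : ℝ
  /-- `χ_L` -/
  χ : ℝ
  /-- `4δe^{δ}h_max` -/
  ra : ℝ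
  /-- `2δe^{δ}/√q` -/
  rb : ℝ
  /-- `2 log q/√q` -/
  rc : ℝ
  /-- `log q` -/
  L : ℝ
  /-- `δ/J` -/
  d : ℝ
  /-- `R(τ₁(w_j))` -/
  Ra : ℕ → ℝ
  /-- `R(τ₁(2δ − w_{j+1}))` -/
  Rb : ℕ → ℝ
  /-- cut value on cell `j` -/
  cb : ℕ → ℝ
  /-- cut-derivative value on cell `j` -/
  cpb : ℕ → ℝ

/-- **Every field of `A` encloses the corresponding real of `X`** (directions of SPEC §1). [this cell, TIER2-KERNEL-SPEC §1] -/
structure AtomsOK (A : Inp) (X : RealAtoms) : Prop where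
  cell : CellAtoms A X.θ₀ X.τ X.M₀ X.M₁₀ X.c₂ X.ε X.R X.Rm
  τ_le : X.τ ≤ val A.tau
  θ₀_lo : val A.th0L ≤ X.θ₀
  θ₀_hi : X.θ₀ ≤ val A.th0H
  u₁_nonneg : 0 ≤ X.u₁
  u₁_le : X.u₁ ≤ val A.u1H
  Mb_nonneg : 0 ≤ X.Mb
  Mb_le : X.Mb ≤ val A.Mbar
  Mb1_nonneg : 0 ≤ X.Mb1
  Mb1_le : X.Mb1 ≤ val A.Mbar1
  E1_nonneg : 0 ≤ X.E1
  E1_le : X.E1 ≤ val A.eD2m1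
  E2_nonneg : 0 ≤ X.E2
  E2_le : X.E2 ≤ val A.eD2m
  E3_nonneg : 0 ≤ X.E3
  E3_le : X.E3 ≤ val A.eD2m_1
  e0_nonneg : 0 ≤ X.e0
  e0_le : X.e0 ≤ val A.et0half
  t0_nonneg : 0 ≤ X.t0
  t0_le : X.t0 ≤ val A.t0
  cA_nonneg : 0 ≤ X.cA
  cA_le : X.cA ≤ val A.coefA
  Λ_nonneg : 0 ≤ X.Λ
  Λ_le : X.Λ ≤ val A.lamSum
  C_nonneg : 0 ≤ X.C
  C_le : X.C ≤ val A.Cpsi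
  T_le : X.T ≤ val A.tailInt
  Gt_le : X.Gt ≤ val A.GtailW
  z_le : X.z ≤ val A.zm1H
  eml_nonneg : 0 ≤ X.eml
  eml_le : X.eml ≤ val A.emL
  χ_nonneg : 0 ≤ X.χ
  χ_le : X.χ ≤ val A.chiL
  ra_nonneg : 0 ≤ X.ra
  ra_le : X.ra ≤ val A.rA
  rb_nonneg : 0 ≤ X.rb
  rb_le : X.rb ≤ val A.rB
  rc_le : X.rc ≤ val A.rcoef
  L_ge : val A.logqL ≤ X.L
  d_ge : val A.dJ ≤ X.d
  Ra_ge : ∀ j < A.gainPairs.length, val (A.gainPairs.getD j (0, 0)).1 ≤ X.Ra j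
  Rb_ge : ∀ j < A.gainPairs.length, val (A.gainPairs.getD j (0, 0)).2 ≤ X.Rb j
  cb_mem : ∀ i, 0 ≤ X.cb i ∧ X.cb i ≤ val (cutC A i)
  cpb_mem : ∀ i, 0 ≤ X.cpb i ∧ X.cpb i ≤ val (cutCp A i)

/-! ## The packaged conclusion -/

/-- **(K1)–(K7) for a certified row**, in the vocabulary the E-side consumes. [this cell, TIER2-KERNEL-SPEC §5] -/
structure T2Valid (A : Inp) (X : RealAtoms) : Prop where
  /-- data facts -/
  m_pos : 1 ≤ A.m
  Jt_le_Kw : A.Jt ≤ A.Kw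
  Kw_pos : 0 < A.Kw
  /-- (K1) `e(t) ≤ envE j` on the closed cell `j < Jt` -/
  envE_le : ∀ j < A.Jt, ∀ t : ℝ, (j : ℝ) * X.τ ≤ t → t ≤ ((j : ℝ) + 1) * X.τ →
    exp (-(A.m + 1 / 2 : ℝ) * t) * Sfun X.θ₀ X.R A.m A.K t * X.cb j ≤ envE A j
  /-- (K1) `e′(t) ≤ envEp j` on the closed cell `j < Jt` -/
  envEp_le : ∀ j < A.Jt, ∀ t : ℝ, (j : ℝ) * X.τ ≤ t → t ≤ ((j : ℝ) + 1) * X.τ →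
    exp (-(1 / 2 : ℝ) * t) * ((X.M₀ / 2 * exp (-(A.m : ℝ) * t) * Sfun X.θ₀ X.R A.m A.K t
        + X.M₁₀ * exp (-(A.m - 1 : ℝ) * t) * S1fun X.θ₀ X.c₂ X.ε X.Rm A.m A.K t) * X.cb j
        + X.M₀ * exp (-(A.m : ℝ) * t) * Sfun X.θ₀ X.R A.m A.K t * X.cpb j) ≤ envEp A j
  /-- (K1) `S(t) ≤ envS j` on the closed cell `j < Jt` -/
  envS_le : ∀ j < A.Jt, ∀ t : ℝ, (j : ℝ) * X.τ ≤ t → t ≤ ((j : ℝ) + 1) * X.τ → Sfun X.θ₀ X.R A.m A.K t ≤ envS A j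
  /-- the layer: `S(t) ≤ val sLayer` on `[j0τ, j1pτ]` when the window is nonempty … -/
  layer_le : A.j0 < A.j1p → ∀ t : ℝ, (A.j0 : ℝ) * X.τ ≤ t → t ≤ (A.j1p : ℝ) * X.τ → Sfun X.θ₀ X.R A.m A.K t ≤ val (sLayerN A)
  /-- … and `sLayer = zm1H` otherwise -/
  layer_tail : ¬ A.j0 < A.j1p → sLayerN A = A.zm1H
  /-- (K4) the lag envelope is the cell envelope on the depth cells … -/
  envX_eq : ∀ i < A.Jt, envX A i = envE A i
  /-- … and dominates `ζ(m+1)e^{−(m+½)iτ}` beyond -/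
  envX_tail : ∀ i, A.Jt ≤ i → i ≤ A.Kw → X.z * exp (-(A.m + 1 / 2 : ℝ) * ((i : ℝ) * X.τ)) ≤ envX A i
  /-- (K4) the hull is non-increasing, -/
  GsR_succ_le : ∀ k, GsR A (k + 1) ≤ GsR A k
  /-- equals the tail value from `Kw` on, -/
  GsR_tail : ∀ k, A.Kw ≤ k → GsR A k = val A.GtailW
  /-- dominates the tail value everywhere, -/
  Gt_le_GsR : ∀ k, X.Gt ≤ GsR A k
  /-- and dominates `e^{−w/2}·τ·lagSum k` on lag cell `k < Kw` (the E4 bound) -/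
  GsR_cell : ∀ k < A.Kw, ∀ w : ℝ, (k : ℝ) * X.τ ≤ w → exp (-(1 / 2 : ℝ) * w) * (X.τ * lagSum A k) ≤ GsR A k
  /-- (K2) `Ā ≥` the cell sum of squares + tail -/
  A_ge : 2 * X.u₁ * (X.τ * X.M₀ ^ 2 * ∑ j ∈ range A.Jt, envE A j ^ 2 + X.Mb ^ 2 * X.E1 / (2 * A.m + 1)) ≤ val (run A).Ahi
  /-- (K2) `B̄ ≥` the cell sum of squares + tails -/
  B_ge : 2 * X.u₁ * (X.τ * ∑ j ∈ range A.Jt, envEp A j ^ 2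
      + (X.Mb ^ 2 / 4 * X.E1 / (2 * A.m + 1) + X.Mb * X.Mb1 * X.E2 / (2 * A.m) + X.Mb1 ^ 2 * X.E3 / (2 * A.m - 1)))
      ≤ val (run A).Bhi
  /-- (K3)–(K7): `primesC + cross + arch + rterm < gain` as ONE real inequality -/
  loss_lt_gain :
    4 * X.Mb ^ 2 * X.u₁ / (2 * A.m + 1) * X.Λ
      + 2 * X.C * X.M₀ ^ 2 * (GsR A 0 + ∑ k ∈ range A.Kw, GsR A k * (exp (((k : ℝ) + 1) * X.τ) - exp ((k : ℝ) * X.τ)) + X.T)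
      + (val (run A).Bhi * X.e0 * X.t0 ^ 2 / 4 + val (run A).Ahi * X.cA)
      + X.rc * (X.ra * (X.M₀ * val (sLayerN A) * X.eml) * X.χ + X.rb * (X.M₀ * val (sLayerN A) * X.eml) ^ 2 * X.χ ^ 2)
      < 2 * X.L * (2 * ∑ j ∈ range A.gainPairs.length, X.d * X.Ra j * X.Rb j)

/-- **`certify_sound`** — the tier-2 kernel verdict implies (K1)–(K7) for any real data enclosed by the atoms.
[this cell, TIER2-KERNEL-SPEC §0/§5; THETA-CERT-cc6 §E6] -/
theorem certify_sound (A : Inp) (X : RealAtoms) (hX : AtomsOK A X) (h : certifyT2 A = true) : T2Valid A X := by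
  obtain ⟨h0, heL, heH, hszN, hJK, hKw, hm, hj1, hlg⟩ := certifyT2_spec A h
  have hJK1 : A.Jt ≤ A.Kw + 1 := Nat.le_succ_of_le hJK
  have hsz := stage1_size_of_nat A hszN
  have hA := hX.cell
  have hτ0 := hA.τ_pos
  obtain ⟨hloss, hgain, hAhi, hBhi⟩ := runSt_fields A (stage1 A)
  -- the four parts and the gain
  have hP := stage2_primesC_sound A (stage1 A) hX.u₁_nonneg hX.u₁_le hX.Mb_nonneg hX.Mb_le hX.Λ_nonneg hX.Λ_le
  have hC := cross_sound A hJK1 hKw hτ0.le hA.etL hA.etH hX.C_nonneg hX.C_le hA.M₀_nonneg hA.M₀_le hX.T_le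
  have hAr := stage2_arch_sound A (stage1 A) (le_refl (val (stage2 A (stage1 A)).Bhi)) (le_refl (val (stage2 A (stage1 A)).Ahi))
    hX.e0_nonneg hX.e0_le hX.t0_nonneg hX.t0_le hX.cA_nonneg hX.cA_le
  have hML : X.M₀ * val (sLayerN A) * X.eml ≤ val (mulU (mulU A.M0 (sLayerN A)) A.emL) :=
    layerM_le A hA.M₀_le (val_nonneg _) le_rfl hX.eml_nonneg hX.eml_le
  have hML0 : 0 ≤ X.M₀ * val (sLayerN A) * X.eml := mul_nonneg (mul_nonneg hA.M₀_nonneg (val_nonneg _)) hX.eml_nonneg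
  have hR := rTerm_sound A hX.rc_le hX.ra_le hX.rb_le hML0 hML hX.χ_nonneg hX.χ_le hX.ra_nonneg hX.rb_nonneg
  have hG := gainLo_sound A hX.L_ge hX.d_ge hX.Ra_ge hX.Rb_ge
  have hlt : val (runSt A (stage1 A)).loss < val (runSt A (stage1 A)).gain := val_lt_val.2 hlg
  rw [hloss, hgain, val_add, val_add, val_add] at hlt
  refine ⟨hm, hJK, hKw, ?_, ?_, ?_, ?_, ?_, ?_, ?_, ?_, ?_, ?_, ?_, ?_, ?_, ?_⟩
  · intro j hj t ht1 ht2
    exact stage1_envE_le A hA heL heH hX.θ₀_lo hX.θ₀_hi h0 hsz hX.cb_mem hj ht1 ht2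
  · intro j hj t ht1 ht2
    exact stage1_envEp_le A hA heL heH hX.θ₀_lo hX.θ₀_hi h0 hsz hX.cb_mem hX.cpb_mem hj ht1 ht2
  · intro j hj t ht1 ht2
    exact stage1_envS_le A hA heL heH hX.θ₀_lo hX.θ₀_hi h0 hsz hj ht1 ht2
  · intro hj t ht1 ht2
    exact stage1_layer_le A hA heL heH hX.θ₀_lo hX.θ₀_hi h0 hsz hj hj1 ht1 ht2
  · exact sLayerN_of_not_lt A
  · exact fun i hi => envX_eq_envE A hi
  · intro i h1 h2
    exact envX_tail_exp A hX.z_le hA.emhStep h1 h2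
  · exact GsR_succ_le A hJK1
  · exact fun k hk => GsR_of_le A hJK1 hk
  · exact fun k => hX.Gt_le.trans (tail_le_GsR A hJK1 k)
  · intro k hk w hw
    exact GsR_cell_bound A hJK1 hτ0.le hX.τ_le hA.ehStep hk hw
  · rw [run_eq_runSt, hAhi]
    exact stage2_Ahi_sound A hX.u₁_le hτ0.le hX.τ_le hA.M₀_nonneg hA.M₀_le hX.Mb_nonneg hX.Mb_le hX.E1_nonneg hX.E1_le
  · rw [run_eq_runSt, hBhi]
    exact stage2_Bhi_sound A hm hX.u₁_le hτ0.le hX.τ_le hX.Mb_nonneg hX.Mb_le hX.Mb1_nonneg hX.Mb1_le hX.E1_nonneg hX.E1_le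
      hX.E2_nonneg hX.E2_le hX.E3_nonneg hX.E3_le
  · rw [run_eq_runSt, hAhi, hBhi]
    linarith

end Summit.RiemannHypothesis.RiemannHypothesis.Theorems.ThetaTier2
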